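import Summits.CriticalPhenomena.PercolationContinuityZ3.Theorems.Transplant.CayleyVirtuallyNilpotentDichotomy
import Summits.CriticalPhenomena.PercolationContinuityZ3.Theorems.Transplant.AutZSqCriticalProbLtOne
import Summits.CriticalPhenomena.PercolationContinuityZ3.Theorems.Transplant.AutVirtuallyCyclicQuasiTransitive
import Mathlib.GroupTheory.Schreier
import HarnessLib

/-!
# The QUASI-TRANSITIVE virtually nilpotent dichotomy (kernel, unconditional): finitely many orbits, finite stabilisers, a finite-index nilpotent
# subgroup ⟹ (`p_c(G) < 1 ⟺` the group is not virtually cyclic) — Benjamini–Schramm's own setting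

builds on p205010 (kernel theorem, internal audit signed; external expert review pending) — nothing in this file uses p205010; unconditional, no node.
Lane `prim-bschramm`, seat `prim-bschramm-p4` gen 22 (PART C3 of `P4-GENERAL.md` §44).  Helper file (`--supports stmt-CriticalPhenomena-4575 --as helper`).

THE POINT.  Benjamini–Schramm state Conjectures 1 and 4 for QUASI-transitive graphs.  **`VirtNilpotentAutQT.criticalProb_lt_one_iff_not_virtuallyCyclic`**:
`G` connected, locally finite; `A` acting by automorphisms with finitely many orbits (representatives `T`) and finite stabilisers of the representatives;
`N ≤ A` of finite index and nilpotent.  Then `p_c(G, v) < 1 ⟺ A` is not virtually cyclic.  Ingredients: the quasi-transitive generating set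
`S_A = {g | ∃ t, t' ∈ T, g • t' = t ∨ t ∼ g • t'}` (`closure_genSetQT`, finite: `finite_genSetQT`) makes `A` finitely generated, hence `N` (Schreier); `N` not
virtually cyclic ⟹ `b₁(N) ≥ 2` (`Nilpotent.virtuallyCyclic_iff_dependent`) ⟹ `ℤ² ≤ N ≤ A` (`NilPair`) ⟹ `p_c < 1` (`AutZSq.criticalProb_lt_one_of_stabilizers_finite`,
all stabilisers being finite by conjugation, `stabilizer_finite_of_reps`); conversely `AutVirtCycQT.not_virtuallyCyclic_of_criticalProb_lt_one`.
[cite: BenjaminiSchramm1996, §2 Conj. 1, Conj. 4 (quasi-transitive graphs)] [cite: LyonsPeres2016, §7.4 Cor. 7.19; §7.9]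
-/

noncomputable section

namespace Summit.CriticalPhenomena.PercolationContinuityZ3.Theorems.Transplant
open SimpleGraph Literature.Probability.LatticeModels Literature.Probability.Percolation
open scoped Classical

namespace VirtNilpotentAutQT

variable {V : Type} {G : SimpleGraph V} [G.LocallyFinite] {A : Type} [Group A] [MulAction A V]

/-- All stabilisers are finite once the representatives' are (conjugation). [folklore] -/
theorem stabilizer_finite_of_reps (T : Finset V) (horb : ∀ v : V, ∃ a : A, ∃ t ∈ T, a • t = v)
    (hfin : ∀ t ∈ T, (MulAction.stabilizer A t : Set A).Finite) (w : V) : (MulAction.stabilizer A w : Set A).Finite := by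
  obtain ⟨a, t, ht, rfl⟩ := horb w
  refine ((hfin t ht).image fun σ => a * σ * a⁻¹).subset fun x hx => ⟨a⁻¹ * x * a, ?_, by group⟩
  rw [SetLike.mem_coe, MulAction.mem_stabilizer_iff] at hx ⊢
  rw [mul_smul, mul_smul, hx, inv_smul_smul]

variable (G) in
/-- **The quasi-transitive generating set is finite**: `{g | ∃ t t' ∈ T, g • t' = t ∨ t ∼ g • t'}`. [folklore] -/
theorem finite_genSetQT (T : Finset V) (hfin : ∀ t ∈ T, (MulAction.stabilizer A t : Set A).Finite) :
    {g : A | ∃ t ∈ T, ∃ t' ∈ T, g • t' = t ∨ G.Adj t (g • t')}.Finite := by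
  refine (((T.finite_toSet.prod T.finite_toSet).biUnion fun q hq =>
    (AutScaled.finite_movers q.2 q.1 (hfin q.2 hq.2)).union (AutVirtCycQT.finite_adjMovers G (A := A) q.1 q.2 (hfin q.2 hq.2)))).subset ?_
  rintro g ⟨t, ht, t', ht', h⟩
  refine Set.mem_biUnion (x := (t, t')) ⟨ht, ht'⟩ ?_
  rcases h with h | h
  · exact Or.inl h
  · exact Or.inr h

/-- **The quasi-transitive generating set generates** (walk from a representative to `a • t`, factoring through the section). [folklore] -/
theorem closure_genSetQT (hact : IsActionByAut G A) (hc : G.Connected) (T : Finset V) (horb : ∀ v : V, ∃ a : A, ∃ t ∈ T, a • t = v)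
    (hfin : ∀ t ∈ T, (MulAction.stabilizer A t : Set A).Finite) :
    Subgroup.closure (↑(finite_genSetQT G T hfin).toFinset : Set A) = ⊤ := by
  set K := Subgroup.closure (↑(finite_genSetQT G T hfin).toFinset : Set A) with hK
  have hmem : ∀ g : A, (∃ t ∈ T, ∃ t' ∈ T, g • t' = t ∨ G.Adj t (g • t')) → g ∈ K := fun g hg =>
    Subgroup.subset_closure (by rw [Finset.mem_coe, Set.Finite.mem_toFinset]; exact hg)
  choose sa st hst hsec using horb
  -- along any walk `x ⇝ y`: `sa x ⁻¹ * sa y ∈ K`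
  have key : ∀ (x y : V) (p : G.Walk x y), (sa x)⁻¹ * sa y ∈ K := by
    intro x y p
    induction p with
    | nil => rw [inv_mul_cancel]; exact one_mem _
    | @cons x z y hxz _ ih =>
      have h1 : (sa x)⁻¹ * sa z ∈ K := by
        refine hmem _ ⟨st x, hst x, st z, hst z, Or.inr ?_⟩
        rw [mul_smul, hsec z, ← hact (sa x), smul_inv_smul, hsec x]
        exact hxz
      have e : (sa x)⁻¹ * sa y = ((sa x)⁻¹ * sa z) * ((sa z)⁻¹ * sa y) := by group
      rw [e]
      exact mul_mem h1 ih
  refine (Subgroup.eq_top_iff' K).2 fun a => ?_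
  obtain ⟨v₀⟩ := hc.nonempty
  set t₀ : V := st v₀ with ht₀def
  have ht₀ : t₀ ∈ T := hst v₀
  -- `t₀ = sa t₀ • st t₀` gives `sa t₀ ∈ K`; a walk `t₀ ⇝ a • t₀` gives `(sa t₀)⁻¹ sa (a • t₀) ∈ K`; and `sa (a • t₀)⁻¹ * a` fixes-or-moves reps
  have h0 : sa t₀ ∈ K := hmem _ ⟨t₀, ht₀, st t₀, hst t₀, Or.inl (hsec t₀)⟩
  obtain ⟨p⟩ := hc.preconnected t₀ (a • t₀)
  have h1 := key _ _ p
  have h2 : (sa (a • t₀))⁻¹ * a ∈ K := by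
    refine hmem _ ⟨st (a • t₀), hst _, t₀, ht₀, Or.inl ?_⟩
    rw [mul_smul, inv_smul_eq_iff]
    exact (hsec (a • t₀)).symm
  have e : a = sa t₀ * ((sa t₀)⁻¹ * sa (a • t₀)) * ((sa (a • t₀))⁻¹ * a) := by group
  rw [e]
  exact mul_mem (mul_mem h0 h1) h2

/-- **THEOREM (the quasi-transitive virtually nilpotent dichotomy, kernel, unconditional).**  `A` acting by automorphisms on a connected locally finite
`G` with finitely many orbits (representatives `T`) and finite stabilisers of the representatives, `N ≤ A` a finite-index NILPOTENT subgroup: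
`p_c(G, v) < 1 ⟺ A` is not virtually cyclic. [cite: BenjaminiSchramm1996, §2 Conj. 1, Conj. 4] [cite: LyonsPeres2016, §7.4 Cor. 7.19; §7.9] -/
theorem criticalProb_lt_one_iff_not_virtuallyCyclic (hact : IsActionByAut G A) (hc : G.Connected) (T : Finset V)
    (horb : ∀ v : V, ∃ a : A, ∃ t ∈ T, a • t = v) (hfin : ∀ t ∈ T, (MulAction.stabilizer A t : Set A).Finite)
    (N : Subgroup A) [N.FiniteIndex] [Group.IsNilpotent N] (v : V) :
    criticalProb G v < 1 ↔ ¬ ∃ c : A, (Subgroup.zpowers c).FiniteIndex := by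
  refine ⟨AutVirtCycQT.not_virtuallyCyclic_of_criticalProb_lt_one hact hc T horb hfin, fun hnvc => ?_⟩
  haveI : Group.FG A := ⟨⟨(finite_genSetQT G T hfin).toFinset, closure_genSetQT hact hc T horb hfin⟩⟩
  haveI : Group.FG N := Subgroup.fg_of_index_ne_zero N
  obtain ⟨-, S, -, hS⟩ := Group.fg_iff'.1 (inferInstance : Group.FG N)
  have hN : ¬ ∃ c : N, (Subgroup.zpowers c).FiniteIndex := fun ⟨c, hc'⟩ =>
    hnvc ⟨(c : A), VirtNilpotent.finiteIndex_zpowers_of_subgroup N c hc'⟩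
  obtain ⟨x, y, hxy, hind⟩ := Nilpotent.exists_commuting_independent_pair_of_not_virtuallyCyclic S hS hN
  refine AutZSq.criticalProb_lt_one_of_stabilizers_finite hact hc (stabilizer_finite_of_reps T horb hfin) (a := (x : A)) (b := (y : A))
    (congrArg Subtype.val hxy.eq) (fun m n h => hind m n ?_) v
  apply Subtype.ext
  rw [Subgroup.coe_mul, Subgroup.coe_zpow, Subgroup.coe_zpow, Subgroup.coe_one]
  exact h

end VirtNilpotentAutQT

end Summit.CriticalPhenomena.PercolationContinuityZ3.Theorems.Transplant
end
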